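import Literature.NumberTheory.Multiplicative.Balazard1990.FiniteRange
import Literature.NumberTheory.Multiplicative.Balazard1990.KernelTab
import HarnessLib

/-!
# Balazard (1990), Question 2 for `σ`: the top of the range `σ(x, K−i)`, `0 ≤ i ≤ 4`, as a step function on
# 84 breakpoints

Source: M. Balazard, *Quelques exemples de suites unimodales en théorie des nombres*, Séminaire de Théorie des
Nombres de Bordeaux (2) **2** (1990) 13–30, doi:10.5802/jtnb.17 (open access) [Balazard1990], p. 27 Question 2
(with p. 14: log-concavity, p. 20: `σ(x,k)`).  PRIMARY READ from the vendored page-image excerpt of the H21 archive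
(`archive/2001-boxes/tp/literature/sources/balazard-1990-jtnb2-unimodales/EXCERPTS-prove-tp-omega-count-log-concavity.md`,
§BZ9 = p. 27, §BZ5 = p. 14, §BZ6 = p. 20).

* TOP IDENTITY `sigma_top` (2001 programme, Lemma 3, in integers): for `K ≥ 12`, `x < 2^{K+1}`, `0 ≤ i ≤ 4`,
  `σ(x, K−i) = Ncount i ⌊x/2^{K−12}⌋`, `Ncount i c = #{m < 2^13 odd : m·2^{12−i−Ω(m)} ≤ c}` — the bijection
  `n = 2^a m ↦ m` (`Finset.card_nbij'` with `ordCompl[2]`), the constraint `Ω(m) ≤ K − i` being automatic since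
  `3^{Ω(m)} ≤ m < 2^{Ω(m)+5}` forces `Ω(m) ≤ 8` (`two_pow_le_three_pow_of_ge`, `cardFactors_le_eight_of_lt_8192`);
* TABLE `wTable_eq` (2001 Lemma 2 / Table 1; the kernel pass of `Literature.NumberTheory.Multiplicative.Balazard1990.KernelTab`): the values
  `w(m) = m·2^{8−Ω(m)} < 2^13` over the odd `m < 2^13` are an explicit list of `84` numbers, and
  `Ncount_eq_NW : Ncount i c = NW i c := #{w ∈ wTable : w·2^{4−i} ≤ c}` (`i ≤ 4`, `c < 2^13`), `NW_mono`, and the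
  27 kernel-evaluated values `NW_…` used by the nine blocks of `Literature.NumberTheory.Multiplicative.Balazard1990.Blocks`.

Modules: `Literature.NumberTheory.Multiplicative.Balazard1990.Compute` (kernel-computable data: trial-division `Ω`, the row pass, the breakpoint table),
`KernelFin` / `KernelTab` (the `decide +kernel` evaluations), `Basic` (§§1–3: `sigma`, `IsLogConcave`, `E`, the four
readings `Question2Sigma…`, `omegaC = Ω`, elementary facts), `FiniteRange` (§§4–5: `x < 2^12`, the witness `x = 16`,
`question2Sigma_false`), `TopRange` (§§6–7: `σ(x,K−i)` as a step function, the 84 breakpoints), `Blocks` (§§8–9: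
the nine blocks, `isLogConcave_sigma_iff_mem_E`, `question2SigmaEventually_false`).

Provenance: refutations bundle `papers/_cross/refutations` (H21 seat pub-refute-2, 2026-08-18), package module
`Refutations.Balazard1990 (§§6–7)`, moved into the tree under the Lean-in-tree rule (human 2026-08-18).  The
classification `E` and the proof structure are the 2001 H21 programme's (archive route `tp/omega-count-log-concavity`,
Theorem 1, "review: upheld"); the bundle's exact Python certificate `numerics/balazard1990/check_balazard_sigma_Q2.py`
checks the same two legs independently.
-/

open scoped ArithmeticFunction.Omega

namespace Literature.NumberTheory.Multiplicative.Balazard1990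

/-! ## 6. The top of the range: `σ(x, K-i)`, `0 ≤ i ≤ 4`, as values of one step function -/

/-- For `i ≤ 4` and an integer `c < 2^13`: the number of odd `m < 2^13` with `m · 2^(12-i-Ω(m)) ≤ c`.
With `c = ⌊2^12 · x/2^K⌋` this is `N(2^i y)`, `y = x/2^K`, for the step function
`N(t) = #{m odd : m ≤ t · 2^{Ω(m)}}` of the 2001-programme paper (Lemma 3). [folklore] -/
def Ncount (i c : ℕ) : ℕ :=
  ((Finset.range 8192).filter (fun m => Odd m ∧ m * 2 ^ (12 - i - Ω m) ≤ c)).card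

/-- Auxiliary lemma: `{j : ℕ} (hj : 9 ≤ j) : 2 ^ (j + 5) ≤ 3 ^ j`. [folklore] -/
theorem two_pow_le_three_pow_of_ge {j : ℕ} (hj : 9 ≤ j) : 2 ^ (j + 5) ≤ 3 ^ j := by
  induction j, hj using Nat.le_induction with
  | base => norm_num
  | succ j _ ih =>
    calc 2 ^ (j + 1 + 5) = 2 * 2 ^ (j + 5) := by ring
      _ ≤ 2 * 3 ^ j := Nat.mul_le_mul_left 2 ih
      _ ≤ 3 * 3 ^ j := Nat.mul_le_mul_right _ (by norm_num)
      _ = 3 ^ (j + 1) := by ring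

/-- An odd `m < 2^(Ω(m) + 5)` has `Ω(m) ≤ 8` (since `3^{Ω(m)} ≤ m`). [folklore] -/
theorem cardFactors_le_eight_of_lt {m : ℕ} (hm : Odd m) (h : m < 2 ^ (Ω m + 5)) : Ω m ≤ 8 := by
  by_contra h'
  have h1 := two_pow_le_three_pow_of_ge (show 9 ≤ Ω m by omega)
  have h2 := three_pow_cardFactors_le hm
  omega

/-- Auxiliary lemma: `{m : ℕ} (hm : Odd m) (h : m < 8192) : Ω m ≤ 8`. [folklore] -/
theorem cardFactors_le_eight_of_lt_8192 {m : ℕ} (hm : Odd m) (h : m < 8192) : Ω m ≤ 8 := by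
  by_contra h'
  have h1 : 3 ^ 9 ≤ 3 ^ Ω m := Nat.pow_le_pow_right (by norm_num) (by omega)
  have h2 := three_pow_cardFactors_le hm
  omega

/-- **Top identity** (2001 paper, Lemma 3, in integer form). For `K ≥ 12`, `x < 2^{K+1}` (in the application
also `2^K ≤ x`) and `0 ≤ i ≤ 4`: `σ(x, K-i) = Ncount i ⌊x / 2^{K-12}⌋`; the bijection is `n = 2^a m ↦ m`, `m` odd,
and the constraint `Ω(m) ≤ K - i` is automatic because `3^{Ω(m)} ≤ m < 2^{Ω(m)+5}` forces `Ω(m) ≤ 8`. [folklore] -/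
theorem sigma_top {K x i : ℕ} (hK : 12 ≤ K) (hx2 : x < 2 ^ (K + 1)) (hi : i ≤ 4) :
    sigma x (K - i) = Ncount i (x / 2 ^ (K - 12)) := by
  unfold sigma Ncount
  have hpos : 0 < 2 ^ (K - 12) := Nat.two_pow_pos _
  -- `x < 2^(K+1) = 2^13 · 2^(K-12)`
  have hx3 : x < 8192 * 2 ^ (K - 12) := by
    calc x < 2 ^ (K + 1) := hx2
      _ = 2 ^ 13 * 2 ^ (K - 12) := by rw [← pow_add]; congr 1; omega
      _ = 8192 * 2 ^ (K - 12) := by norm_num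
  apply Finset.card_nbij' (fun n => ordCompl[2] n) (fun m => m * 2 ^ (K - i - Ω m))
  · -- maps `S` into `T`
    intro n hn
    rw [Finset.mem_coe, Finset.mem_filter, Finset.mem_Icc] at hn
    obtain ⟨⟨hn1, hnx⟩, hΩ⟩ := hn
    have hn0 : n ≠ 0 := by omega
    set m := ordCompl[2] n with hm_def
    set v := n.factorization 2 with hv_def
    have hdecomp : 2 ^ v * m = n := Nat.ordProj_mul_ordCompl_eq_self n 2
    have hm0 : m ≠ 0 := (Nat.ordCompl_pos 2 hn0).ne'
    have hmodd : Odd m := by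
      rw [← Nat.not_even_iff_odd, even_iff_two_dvd]
      exact Nat.not_dvd_ordCompl Nat.prime_two hn0
    have hΩn : Ω n = v + Ω m := by
      rw [← hdecomp, ArithmeticFunction.cardFactors_mul (pow_ne_zero _ two_ne_zero) hm0,
        ArithmeticFunction.cardFactors_apply_prime_pow Nat.prime_two]
    have h3 := three_pow_cardFactors_le hmodd
    -- `m < 2^(Ω m + 5)`: from `2^v m = n < 2^(K+1)` and `v = K - i - Ω m`
    have hv : v = K - i - Ω m := by omega
    have hm_lt : m < 2 ^ (Ω m + 5) := by
      by_contra hge'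
      have hge := Nat.le_of_not_lt hge'
      have : 2 ^ (K + 1) ≤ 2 ^ v * m := by
        calc 2 ^ (K + 1) ≤ 2 ^ v * 2 ^ (Ω m + 5) := by
              rw [← pow_add]; exact Nat.pow_le_pow_right (by norm_num) (by omega)
          _ ≤ 2 ^ v * m := Nat.mul_le_mul_left _ hge
      omega
    have hj8 := cardFactors_le_eight_of_lt hmodd hm_lt
    rw [Finset.mem_coe, Finset.mem_filter, Finset.mem_range]
    refine ⟨?_, hmodd, ?_⟩
    · calc m < 2 ^ (Ω m + 5) := hm_lt
        _ ≤ 2 ^ 13 := Nat.pow_le_pow_right (by norm_num) (by omega)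
        _ = 8192 := by norm_num
    · rw [Nat.le_div_iff_mul_le hpos, mul_assoc, ← pow_add,
        show 12 - i - Ω m + (K - 12) = v by omega, mul_comm, hdecomp]
      exact hnx
  · -- maps `T` into `S`
    intro m hm
    rw [Finset.mem_coe, Finset.mem_filter, Finset.mem_range] at hm
    obtain ⟨hm_lt, hmodd, hmc⟩ := hm
    have hm0 : m ≠ 0 := by rintro rfl; exact absurd hmodd (by decide)
    have hj8 := cardFactors_le_eight_of_lt_8192 hmodd hm_lt
    rw [Finset.mem_coe, Finset.mem_filter, Finset.mem_Icc]
    refine ⟨⟨le_trans (show 1 ≤ m by omega) (Nat.le_mul_of_pos_right m (Nat.two_pow_pos _)), ?_⟩, ?_⟩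
    · rw [Nat.le_div_iff_mul_le hpos, mul_assoc, ← pow_add,
        show 12 - i - Ω m + (K - 12) = K - i - Ω m by omega] at hmc
      exact hmc
    · rw [ArithmeticFunction.cardFactors_mul hm0 (pow_ne_zero _ two_ne_zero),
        ArithmeticFunction.cardFactors_apply_prime_pow Nat.prime_two]
      omega
  · -- left inverse on `S`
    intro n hn
    rw [Finset.mem_coe, Finset.mem_filter, Finset.mem_Icc] at hn
    obtain ⟨⟨hn1, _⟩, hΩ⟩ := hn
    have hn0 : n ≠ 0 := by omega
    have hdecomp : 2 ^ n.factorization 2 * ordCompl[2] n = n := Nat.ordProj_mul_ordCompl_eq_self n 2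
    have hm0 : ordCompl[2] n ≠ 0 := (Nat.ordCompl_pos 2 hn0).ne'
    have hΩn : Ω n = n.factorization 2 + Ω (ordCompl[2] n) := by
      conv_lhs => rw [← hdecomp]
      rw [ArithmeticFunction.cardFactors_mul (pow_ne_zero _ two_ne_zero) hm0,
        ArithmeticFunction.cardFactors_apply_prime_pow Nat.prime_two]
    simp only
    rw [show K - i - Ω (ordCompl[2] n) = n.factorization 2 by omega, mul_comm]
    exact hdecomp
  · -- right inverse on `T`
    intro m hm
    rw [Finset.mem_coe, Finset.mem_filter, Finset.mem_range] at hm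
    obtain ⟨_, hmodd, _⟩ := hm
    simp only
    rw [mul_comm, Nat.ordCompl_self_pow_mul _ _ Nat.prime_two,
      (Nat.ordCompl_eq_self_iff_zero_or_not_dvd m Nat.prime_two).mpr]
    right
    rw [← even_iff_two_dvd, Nat.not_even_iff_odd]
    exact hmodd


/-! ## 7. The step function on the 84 breakpoints (2001 paper, Lemma 2 / Table 1) -/

/-- `card` of a filtered `Finset.range` as the length of the filtered list. [folklore] -/
theorem card_filter_range_eq_length (P : ℕ → Prop) [DecidablePred P] (n : ℕ) :
    ((Finset.range n).filter P).card = ((List.range n).filter (fun m => decide (P m))).length := by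
  induction n with
  | zero => simp
  | succ n ih =>
    rw [Finset.range_add_one, Finset.filter_insert, List.range_succ, List.filter_append, List.length_append]
    by_cases h : P n
    · rw [if_pos h, Finset.card_insert_of_notMem (by simp), ih]
      simp [h]
    · rw [if_neg h, ih]
      simp [h]

/-- The odd members of `range (2n)` are `2t+1`, `t < n` (as filtered lists). [folklore] -/
theorem filter_odd_range (R : ℕ → Prop) [DecidablePred R] (n : ℕ) :
    (List.range (2 * n)).filter (fun m => decide (Odd m ∧ R m)) =
      ((List.range n).map (fun t => 2 * t + 1)).filter (fun m => decide (R m)) := by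
  induction n with
  | zero => simp
  | succ n ih =>
    rw [show 2 * (n + 1) = 2 * n + 1 + 1 by ring, List.range_succ, List.range_succ, List.filter_append,
      List.filter_append, ih, List.range_succ, List.map_append, List.filter_append]
    have h1 : ¬ Odd (2 * n) := by rw [Nat.not_odd_iff_even]; exact even_two_mul n
    have h2 : Odd (2 * n + 1) := odd_two_mul_add_one n
    simp [List.filter_cons, h1, h2]

/-! `wC m = m · 2^(8 - omegaC m)` and the 84-entry table `wTable` (the `w`-values `< 2^13` over odd `m < 2^13`, by
increasing `m`; the `84` odd `m` with `q_m = m/2^{Ω(m)} < 32` of the 2001 paper, Lemma 2 / Table 1) are defined in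
module `Compute`; the kernel certifies the table in four chunks (`KernelTab1..4.lean`). -/

/-- Certificate of Table 1: running over ALL odd `m < 2^13` (trial-division `Ω`), the values
`w(m) = m·2^(8-Ω(m))` below `2^13` are exactly `wTable` — assembled from the four kernel-evaluated chunks
`wScan_chunk1..4` (`Refutations/Balazard1990/KernelTab1..4.lean`, `decide +kernel`, 4096 factorisations in all). [folklore] -/
theorem wTable_eq :
    (((List.range 4096).map (fun t => 2 * t + 1)).filterMap
      (fun m => if wC m < 8192 then some (wC m) else none)) = wTable := by
  have e : List.range 4096 =
      List.range' 0 1024 ++ List.range' 1024 1024 ++ List.range' 2048 1024 ++ List.range' 3072 1024 := by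
    decide +kernel
  rw [e]
  simp only [List.map_append, List.filterMap_append]
  show wScan 0 1024 ++ wScan 1024 1024 ++ wScan 2048 1024 ++ wScan 3072 1024 = wTable
  rw [wScan_chunk1, wScan_chunk2, wScan_chunk3, wScan_chunk4]
  exact wTable_chunks

/-- `N_i(c)` read off the table: the number of entries `w` of `wTable` with `w · 2^(4-i) ≤ c`. [folklore] -/
def NW (i c : ℕ) : ℕ := (wTable.filter (fun w => w * 2 ^ (4 - i) ≤ c)).length

/-- Auxiliary lemma: `(l : List ℕ) (f : ℕ → ℕ) (B : ℕ) (g : ℕ → Bool) : (l.filter (fun a => decide (f a < B) && g (f a))).length = ((l.filterMap (fun a => if f a < B then some (f a) else none)).filter g).length`. [folklore] -/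
theorem length_filter_filterMap_aux (l : List ℕ) (f : ℕ → ℕ) (B : ℕ) (g : ℕ → Bool) :
    (l.filter (fun a => decide (f a < B) && g (f a))).length =
      ((l.filterMap (fun a => if f a < B then some (f a) else none)).filter g).length := by
  induction l with
  | nil => simp
  | cons a l ih =>
    rw [List.filter_cons, List.filterMap_cons]
    by_cases h : f a < B
    · cases hg : g (f a) <;> simp [h, hg, ih]
    · simp [h, ih]

/-- For `i ≤ 4` and `c < 2^13`, `Ncount i c` is the table count `NW i c`. [folklore] -/
theorem Ncount_eq_NW {i c : ℕ} (hi : i ≤ 4) (hc : c < 8192) : Ncount i c = NW i c := by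
  unfold Ncount NW
  rw [card_filter_range_eq_length, show (8192 : ℕ) = 2 * 4096 by norm_num, filter_odd_range, ← wTable_eq,
    ← length_filter_filterMap_aux]
  -- (not `congr 1`: its closing `rfl` attempt would unfold `List.range 4096`)
  refine congrArg List.length ?_
  apply List.filter_congr
  intro m hm
  rw [List.mem_map] at hm
  obtain ⟨t, ht, rfl⟩ := hm
  rw [List.mem_range] at ht
  have hmodd : Odd (2 * t + 1) := odd_two_mul_add_one t
  have hj8 := cardFactors_le_eight_of_lt_8192 hmodd (by omega)
  have hw : wC (2 * t + 1) = (2 * t + 1) * 2 ^ (8 - Ω (2 * t + 1)) := by rw [wC, omegaC_eq]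
  rw [hw, ← Bool.decide_and, decide_eq_decide]
  have e : 2 ^ (12 - i - Ω (2 * t + 1)) = 2 ^ (8 - Ω (2 * t + 1)) * 2 ^ (4 - i) := by
    rw [← pow_add]; congr 1; omega
  constructor
  · intro hA
    have hC : (2 * t + 1) * 2 ^ (8 - Ω (2 * t + 1)) * 2 ^ (4 - i) ≤ c := by rwa [mul_assoc, ← e]
    refine ⟨?_, hC⟩
    have : (2 * t + 1) * 2 ^ (8 - Ω (2 * t + 1)) ≤ (2 * t + 1) * 2 ^ (8 - Ω (2 * t + 1)) * 2 ^ (4 - i) :=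
      Nat.le_mul_of_pos_right _ (Nat.two_pow_pos _)
    omega
  · rintro ⟨-, hC⟩
    rwa [mul_assoc, ← e] at hC

/-- Auxiliary lemma: `(l : List ℕ) (p q : ℕ → Bool) (h : ∀ a, p a → q a) : (l.filter p).length ≤ (l.filter q).length`. [folklore] -/
theorem length_filter_le_of_imp (l : List ℕ) (p q : ℕ → Bool) (h : ∀ a, p a → q a) :
    (l.filter p).length ≤ (l.filter q).length :=
  (List.monotone_filter_right l h).length_le

/-- `N_i` is non-decreasing in `c` (the 2001 paper's "N is a non-decreasing step function"). [folklore] -/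
theorem NW_mono (i : ℕ) {c c' : ℕ} (h : c ≤ c') : NW i c ≤ NW i c' :=
  length_filter_le_of_imp _ _ _ (fun w hw => by simp only [decide_eq_true_eq] at hw ⊢; omega)

/-! The 27 values of `N` entering the nine-block table (2001 paper, Table 2): on the block
`[β_r, β_{r+1})` of `y = x/2^K`, i.e. `a_r ≤ u = ⌊2^12 y⌋ < a_{r+1}` with `a = 4096 β`, the bound
`U_r = N_i(a_{r+1} - 1)`, and `L⁻_r = N_{i-1}(a_r)`, `L⁺_r = N_{i+1}(a_r)`. -/

/-- `NW 1 4607 = 2` (kernel evaluation, `decide +kernel`). [folklore] -/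
theorem NW_1_4607 : NW 1 4607 = 2 := by decide +kernel
/-- `NW 0 4096 = 1` (kernel evaluation, `decide +kernel`). [folklore] -/
theorem NW_0_4096 : NW 0 4096 = 1 := by decide +kernel
/-- `NW 2 4096 = 7` (kernel evaluation, `decide +kernel`). [folklore] -/
theorem NW_2_4096 : NW 2 4096 = 7 := by decide +kernel
/-- `NW 2 5183 = 7` (kernel evaluation, `decide +kernel`). [folklore] -/
theorem NW_2_5183 : NW 2 5183 = 7 := by decide +kernel
/-- `NW 1 4608 = 3` (kernel evaluation, `decide +kernel`). [folklore] -/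
theorem NW_1_4608 : NW 1 4608 = 3 := by decide +kernel
/-- `NW 3 4608 = 19` (kernel evaluation, `decide +kernel`). [folklore] -/
theorem NW_3_4608 : NW 3 4608 = 19 := by decide +kernel
/-- `NW 2 5631 = 9` (kernel evaluation, `decide +kernel`). [folklore] -/
theorem NW_2_5631 : NW 2 5631 = 9 := by decide +kernel
/-- `NW 1 5184 = 4` (kernel evaluation, `decide +kernel`). [folklore] -/
theorem NW_1_5184 : NW 1 5184 = 4 := by decide +kernel
/-- `NW 3 5184 = 22` (kernel evaluation, `decide +kernel`). [folklore] -/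
theorem NW_3_5184 : NW 3 5184 = 22 := by decide +kernel
/-- `NW 3 5887 = 23` (kernel evaluation, `decide +kernel`). [folklore] -/
theorem NW_3_5887 : NW 3 5887 = 23 := by decide +kernel
/-- `NW 2 5632 = 10` (kernel evaluation, `decide +kernel`). [folklore] -/
theorem NW_2_5632 : NW 2 5632 = 10 := by decide +kernel
/-- `NW 4 5632 = 57` (kernel evaluation, `decide +kernel`). [folklore] -/
theorem NW_4_5632 : NW 4 5632 = 57 := by decide +kernel
/-- `NW 3 6271 = 25` (kernel evaluation, `decide +kernel`). [folklore] -/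
theorem NW_3_6271 : NW 3 6271 = 25 := by decide +kernel
/-- `NW 2 5888 = 11` (kernel evaluation, `decide +kernel`). [folklore] -/
theorem NW_2_5888 : NW 2 5888 = 11 := by decide +kernel
/-- `NW 4 5888 = 58` (kernel evaluation, `decide +kernel`). [folklore] -/
theorem NW_4_5888 : NW 4 5888 = 58 := by decide +kernel
/-- `NW 1 6911 = 4` (kernel evaluation, `decide +kernel`). [folklore] -/
theorem NW_1_6911 : NW 1 6911 = 4 := by decide +kernel
/-- `NW 0 6272 = 2` (kernel evaluation, `decide +kernel`). [folklore] -/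
theorem NW_0_6272 : NW 0 6272 = 2 := by decide +kernel
/-- `NW 2 6272 = 11` (kernel evaluation, `decide +kernel`). [folklore] -/
theorem NW_2_6272 : NW 2 6272 = 11 := by decide +kernel
/-- `NW 1 7167 = 5` (kernel evaluation, `decide +kernel`). [folklore] -/
theorem NW_1_7167 : NW 1 7167 = 5 := by decide +kernel
/-- `NW 0 6912 = 2` (kernel evaluation, `decide +kernel`). [folklore] -/
theorem NW_0_6912 : NW 0 6912 = 2 := by decide +kernel
/-- `NW 2 6912 = 13` (kernel evaluation, `decide +kernel`). [folklore] -/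
theorem NW_2_6912 : NW 2 6912 = 13 := by decide +kernel
/-- `NW 2 7775 = 13` (kernel evaluation, `decide +kernel`). [folklore] -/
theorem NW_2_7775 : NW 2 7775 = 13 := by decide +kernel
/-- `NW 1 7168 = 6` (kernel evaluation, `decide +kernel`). [folklore] -/
theorem NW_1_7168 : NW 1 7168 = 6 := by decide +kernel
/-- `NW 3 7168 = 31` (kernel evaluation, `decide +kernel`). [folklore] -/
theorem NW_3_7168 : NW 3 7168 = 31 := by decide +kernel
/-- `NW 2 8191 = 15` (kernel evaluation, `decide +kernel`). [folklore] -/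
theorem NW_2_8191 : NW 2 8191 = 15 := by decide +kernel
/-- `NW 1 7776 = 7` (kernel evaluation, `decide +kernel`). [folklore] -/
theorem NW_1_7776 : NW 1 7776 = 7 := by decide +kernel
/-- `NW 3 7776 = 35` (kernel evaluation, `decide +kernel`). [folklore] -/
theorem NW_3_7776 : NW 3 7776 = 35 := by decide +kernel

end Literature.NumberTheory.Multiplicative.Balazard1990
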